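import Literature.AlgebraicGeometry.Frobenioids.Frobenioid
import Literature.AlgebraicGeometry.Frobenioids.PreFrobenioidDataOfFunctor
import Literature.AlgebraicGeometry.Frobenioids.BaseCategoryTheoreticity
import HarnessLib

/-!
# Frobenioids I, §3: the category-theoreticity theorems as NAMED FACTS over Frobenioids

Mochizuki, *The geometry of Frobenioids I* (2008), Thm. 3.4 pp. 62–63, Rem. 3.1.1 p. 57, Prop. 3.3
pp. 59–60, Prop. 3.11 p. 73, Thm. 4.2 p. 77, Cor. 4.10 p. 90, Cor. 4.11 pp. 91–92, Cor. 4.12 p. 95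
[cite: MochizukiFrdI2008, Thm. 3.4 pp.62-63]. The statement files `BaseCategoryTheoreticity*.lean`,
`DivisorMonoidCategoryTheoreticity*.lean` type each sub-item as a conclusion predicate over the operations
`PreFrobenioidData`; here the standing hypothesis of §3–§4 — "`C_i → F_{Φ_i}` a Frobenioid" — is
supplied from the cell's Definition 1.3 (`PreFrobenioid.IsFrobenioid`, file `Frobenioid.lean`) through the
adapter `PreFrobenioidData.ofFunctor`, giving the published results as named `Prop` facts (D-0014: unproved
published results are `def … : Prop`; discharging = `theorem …_holds`). The §4 facts (Thm. 4.2 (i), Cor. 4.11 (ii), with perf-factorial bound to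
`IsPerfFactorial`) are in `DivisorMonoidCategoryTheoreticityFacts.lean`; items whose hypotheses or objects are
the data-only interfaces `PerfectionData` / `BiratData` / `RSParams` are deliberately NOT closed into facts
(a `∀` over a data-only interface is refutable by junk instances — RQ7 audit F1/F2). Nothing here is asserted; no statement of the paper is strengthened.
-/

namespace Literature.AlgebraicGeometry.Frobenioids

open CategoryTheory

universe w v v' u u'

namespace FrdI

/-! Binder convention for the two-Frobenioid facts: `D_i : Type u`, `C_i : Type u'` with
`Category.{v}` / `Category.{v'}`, `Φ_i : D_iᵒᵖ ⥤ CommMonCat.{w}`, `F_i : C_i ⥤ F_{Φ_i}` Frobenioids,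
`Ψ : C₁ ≌ C₂`. -/

/-- **[FrdI] Remark 3.1.1** as a named fact: in a Frobenioid an iso-subanchor is never isotropic.
[cite: MochizukiFrdI2008, Rem. 3.1.1 p.57] -/
def Remark311 : Prop :=
  ∀ {D : Type u} [Category.{v} D] {Φ : Dᵒᵖ ⥤ CommMonCat.{w}} {C : Type u'} [Category.{v'} C]
    (F : C ⥤ ElemFrobenioid Φ), PreFrobenioid.IsFrobenioid F →
      Frobenioids.Remark311 (PreFrobenioidData.ofFunctor Φ F)

/-- **[FrdI] Proposition 3.3 (ii)** as a named fact (unit-equivalence ⟺ same image in `F_Φ`).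
[cite: MochizukiFrdI2008, Prop. 3.3 (ii) p.59] -/
def Prop33ii : Prop :=
  ∀ {D : Type u} [Category.{v} D] {Φ : Dᵒᵖ ⥤ CommMonCat.{w}} {C : Type u'} [Category.{v'} C]
    (F : C ⥤ ElemFrobenioid Φ), PreFrobenioid.IsFrobenioid F →
      Frobenioids.Prop33ii (PreFrobenioidData.ofFunctor Φ F)

/-- **[FrdI] Proposition 3.3 (v)** as a named fact (`C → F_Φ` an equivalence iff Aut-ample, unit-trivial,
base-trivial type). [cite: MochizukiFrdI2008, Prop. 3.3 (v) p.60] -/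
def Prop33v : Prop :=
  ∀ {D : Type u} [Category.{v} D] {Φ : Dᵒᵖ ⥤ CommMonCat.{w}} {C : Type u'} [Category.{v'} C]
    (F : C ⥤ ElemFrobenioid Φ), PreFrobenioid.IsFrobenioid F →
      Frobenioids.Prop33v (PreFrobenioidData.ofFunctor Φ F)

/-- **[FrdI] Theorem 3.4 (i)**, preservation part, as a named fact. [cite: MochizukiFrdI2008, Thm. 3.4 (i) p.62] -/
def Thm34i : Prop :=
  ∀ {D₁ : Type u} [Category.{v} D₁] {Φ₁ : D₁ᵒᵖ ⥤ CommMonCat.{w}} {C₁ : Type u'} [Category.{v'} C₁]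
    {D₂ : Type u} [Category.{v} D₂] {Φ₂ : D₂ᵒᵖ ⥤ CommMonCat.{w}} {C₂ : Type u'} [Category.{v'} C₂]
    (F₁ : C₁ ⥤ ElemFrobenioid Φ₁) (F₂ : C₂ ⥤ ElemFrobenioid Φ₂),
      PreFrobenioid.IsFrobenioid F₁ → PreFrobenioid.IsFrobenioid F₂ → ∀ Ψ : C₁ ≌ C₂,
        (PreFrobenioidData.ofFunctor Φ₁ F₁).Thm34i (PreFrobenioidData.ofFunctor Φ₂ F₂) Ψ

/-- **[FrdI] Theorem 3.4 (ii)** as a named fact. [cite: MochizukiFrdI2008, Thm. 3.4 (ii) p.62] -/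
def Thm34ii : Prop :=
  ∀ {D₁ : Type u} [Category.{v} D₁] {Φ₁ : D₁ᵒᵖ ⥤ CommMonCat.{w}} {C₁ : Type u'} [Category.{v'} C₁]
    {D₂ : Type u} [Category.{v} D₂] {Φ₂ : D₂ᵒᵖ ⥤ CommMonCat.{w}} {C₂ : Type u'} [Category.{v'} C₂]
    (F₁ : C₁ ⥤ ElemFrobenioid Φ₁) (F₂ : C₂ ⥤ ElemFrobenioid Φ₂),
      PreFrobenioid.IsFrobenioid F₁ → PreFrobenioid.IsFrobenioid F₂ → ∀ Ψ : C₁ ≌ C₂,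
        (PreFrobenioidData.ofFunctor Φ₁ F₁).Thm34ii (PreFrobenioidData.ofFunctor Φ₂ F₂) Ψ

/-- **[FrdI] Theorem 3.4 (iii)**, preservation and Frobenius degrees, as a named fact.
[cite: MochizukiFrdI2008, Thm. 3.4 (iii) p.62] -/
def Thm34iii : Prop :=
  ∀ {D₁ : Type u} [Category.{v} D₁] {Φ₁ : D₁ᵒᵖ ⥤ CommMonCat.{w}} {C₁ : Type u'} [Category.{v'} C₁]
    {D₂ : Type u} [Category.{v} D₂] {Φ₂ : D₂ᵒᵖ ⥤ CommMonCat.{w}} {C₂ : Type u'} [Category.{v'} C₂]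
    (F₁ : C₁ ⥤ ElemFrobenioid Φ₁) (F₂ : C₂ ⥤ ElemFrobenioid Φ₂),
      PreFrobenioid.IsFrobenioid F₁ → PreFrobenioid.IsFrobenioid F₂ → ∀ Ψ : C₁ ≌ C₂,
        (PreFrobenioidData.ofFunctor Φ₁ F₁).Thm34iii (PreFrobenioidData.ofFunctor Φ₂ F₂) Ψ

/-- **[FrdI] Theorem 3.4 (iv)**, preservation of `O^▷`, `O^×` and of Frobenius degrees, as a named fact.
[cite: MochizukiFrdI2008, Thm. 3.4 (iv) p.63] -/
def Thm34iv : Prop :=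
  ∀ {D₁ : Type u} [Category.{v} D₁] {Φ₁ : D₁ᵒᵖ ⥤ CommMonCat.{w}} {C₁ : Type u'} [Category.{v'} C₁]
    {D₂ : Type u} [Category.{v} D₂] {Φ₂ : D₂ᵒᵖ ⥤ CommMonCat.{w}} {C₂ : Type u'} [Category.{v'} C₂]
    (F₁ : C₁ ⥤ ElemFrobenioid Φ₁) (F₂ : C₂ ⥤ ElemFrobenioid Φ₂),
      PreFrobenioid.IsFrobenioid F₁ → PreFrobenioid.IsFrobenioid F₂ → ∀ Ψ : C₁ ≌ C₂,
        (PreFrobenioidData.ofFunctor Φ₁ F₁).Thm34iv (PreFrobenioidData.ofFunctor Φ₂ F₂) Ψ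

/-- **[FrdI] Theorem 3.4 (v)** (the `1`-unique `Ψ^Base : D₁ ⥤ D₂`), as a named fact.
[cite: MochizukiFrdI2008, Thm. 3.4 (v) p.63] -/
def Thm34v : Prop :=
  ∀ {D₁ : Type u} [Category.{v} D₁] {Φ₁ : D₁ᵒᵖ ⥤ CommMonCat.{w}} {C₁ : Type u'} [Category.{v'} C₁]
    {D₂ : Type u} [Category.{v} D₂] {Φ₂ : D₂ᵒᵖ ⥤ CommMonCat.{w}} {C₂ : Type u'} [Category.{v'} C₂]
    (F₁ : C₁ ⥤ ElemFrobenioid Φ₁) (F₂ : C₂ ⥤ ElemFrobenioid Φ₂),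
      PreFrobenioid.IsFrobenioid F₁ → PreFrobenioid.IsFrobenioid F₂ → ∀ Ψ : C₁ ≌ C₂,
        (PreFrobenioidData.ofFunctor Φ₁ F₁).Thm34v (PreFrobenioidData.ofFunctor Φ₂ F₂) Ψ

/-- **[FrdI] Remark 3.4.1** as a named fact. [cite: MochizukiFrdI2008, Rem. 3.4.1 p.69] -/
def Remark341 : Prop :=
  ∀ {D₁ : Type u} [Category.{v} D₁] {Φ₁ : D₁ᵒᵖ ⥤ CommMonCat.{w}} {C₁ : Type u'} [Category.{v'} C₁]
    {D₂ : Type u} [Category.{v} D₂] {Φ₂ : D₂ᵒᵖ ⥤ CommMonCat.{w}} {C₂ : Type u'} [Category.{v'} C₂]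
    (F₁ : C₁ ⥤ ElemFrobenioid Φ₁) (F₂ : C₂ ⥤ ElemFrobenioid Φ₂),
      PreFrobenioid.IsFrobenioid F₁ → PreFrobenioid.IsFrobenioid F₂ → ∀ Ψ : C₁ ≌ C₂,
        (PreFrobenioidData.ofFunctor Φ₁ F₁).Remark341 (PreFrobenioidData.ofFunctor Φ₂ F₂) Ψ

/-- **[FrdI] Proposition 3.11 (i)** as a named fact. [cite: MochizukiFrdI2008, Prop. 3.11 (i) p.73] -/
def Prop311i : Prop :=
  ∀ {D : Type u} [Category.{v} D] {Φ : Dᵒᵖ ⥤ CommMonCat.{w}} {C : Type u'} [Category.{v'} C]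
    (F : C ⥤ ElemFrobenioid Φ), PreFrobenioid.IsFrobenioid F →
      PreFrobenioidData.Prop311i (PreFrobenioidData.ofFunctor Φ F)

/-- **[FrdI] Proposition 3.11 (ii), (iii)** as a named fact. [cite: MochizukiFrdI2008, Prop. 3.11 (ii) p.73] -/
def Prop311ii_iii : Prop :=
  ∀ {D₁ : Type u} [Category.{v} D₁] {Φ₁ : D₁ᵒᵖ ⥤ CommMonCat.{w}} {C₁ : Type u'} [Category.{v'} C₁]
    {D₂ : Type u} [Category.{v} D₂] {Φ₂ : D₂ᵒᵖ ⥤ CommMonCat.{w}} {C₂ : Type u'} [Category.{v'} C₂]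
    (F₁ : C₁ ⥤ ElemFrobenioid Φ₁) (F₂ : C₂ ⥤ ElemFrobenioid Φ₂),
      PreFrobenioid.IsFrobenioid F₁ → PreFrobenioid.IsFrobenioid F₂ → ∀ Ψ : C₁ ≌ C₂,
        (PreFrobenioidData.ofFunctor Φ₁ F₁).Prop311ii (PreFrobenioidData.ofFunctor Φ₂ F₂) Ψ ∧
          (PreFrobenioidData.ofFunctor Φ₁ F₁).Prop311iii (PreFrobenioidData.ofFunctor Φ₂ F₂) Ψ

end FrdI

end Literature.AlgebraicGeometry.Frobenioids
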